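import Summits.Ventures.QEC.Census.CertCoverBatch
import Summits.Ventures.QEC.Census.BB.S8_126_w6_k12_01061B01.CoreDefs
import HarnessLib

set_option Elab.async false
set_option maxRecDepth 200000

/-!
# `[[252,12,16]]` one-level cover certificate of `S8_126_w6_k12_01061B01` — LEVEL-1→0 coset problems 16…22 (deep problems [0] excluded: `ProbDeep*.lean`) as COMPACT data
(`ProbData`: U, f, σ, y₀, allow; qec-type-10 `CertCoverBatch.mkCoset` rebuilds each `CosetProb` in the kernel) + their verdict
`probsOK cov covR hx hx1 D1 lxd 14` (one `decide +kernel`; 7 problems, depths f=0:5 f=1:0 f=2:2 f=3:0, est. 97.5 s).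
qec-search-1 g5 (pattern of search-9 g5 `Probs*`); data from JSON `level10.problems` (sha256 75f002ace624d82a…). Data + decided check; KERNEL.
-/

namespace Summit.Ventures.QEC.Census.S8_126_w6_k12_01061B01

open Matrix Summit.Ventures.QEC.Census Literature.InformationTheory.QuantumCodes

/-- Problems 16…22 (7): `⟨U, f, σ, y₀, allow⟩`. -/
def probs02 : List ProbData := [
    ⟨193437586248726123493983744, 2, 1152922879281600512, 154751958868136210414437376, [0, 37778931862957161709568]⟩,
    ⟨328969504308773790993613056, 0, 1156865178248152064, 328884492488147150563180800, [0]⟩,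
    ⟨386922406538574759779633152, 0, 3459893438223228928, 77380708717517602304294912, [0]⟩,
    ⟨386979054183781562843136000, 2, 1156301678530527232, 77456264275399957658206208, [0, 1024]⟩,
    ⟨387092432484545699686387712, 0, 5772492397170671616, 309485047870006795442327552, [0]⟩,
    ⟨387205801561937799674863617, 0, 1156299481654788100, 77380780198650338173001729, [0]⟩,
    ⟨435326642235682465518715008, 0, 1156582878633525760, 87118226099351251766476928, [0]⟩]

set_option maxHeartbeats 400000000 in
/-- Every problem of this chunk passes (`mkCoset` elimination + `cosetOKD` + fast `σ` + depth + `BU`-evenness + label checks). -/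
theorem probs02_ok : probsOK S8_126_w6_k12_01061B01.cov covR hx hx1 D1 lxd 14 probs02 = true := by
  decide +kernel

/-- Pointwise form. -/
theorem probs02_all : ∀ x ∈ S8_126_w6_k12_01061B01.probs02, probOK cov covR hx hx1 D1 lxd 14 x = true := by
  have h := probs02_ok
  rwa [probsOK, List.all_eq_true] at h

end Summit.Ventures.QEC.Census.S8_126_w6_k12_01061B01
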